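import Literature.Probability.RandomPlanarGeometry.HexSAWObservableRot
import Literature.Probability.RandomPlanarGeometry.HexSAWBrickWallBridgeSurgery
import Literature.Probability.RandomPlanarGeometry.HexSAWBrickWallBridgeDivergence
import Literature.Probability.RandomPlanarGeometry.HexSAWHammersleyWelshExplicit
import HarnessLib

/-!
# Beaton's rotated strip domains and the dictionary «brick-wall bridges of span `A` ↦ walks to the top of `D(A, ·)`»

Topic `Literature/Probability/RandomPlanarGeometry` (continues `HexSAWObservableRot.lean` — Beaton's height
`HV.xi`, the rotated frame — , `HexSAWBrickWallBridgeSurgery.lean` — the list-model bridges `HV.bridgeFin N` of `ℍ`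
by the brick-wall abscissa `HV.ht`, `toBW`, `image_toBW_bridgeFin` — and `HexSAWBrickWallBridgeDivergence.lean` — the
brick-wall bridges of span `A`, `HexBW.brSpan m A`).  Sources: N. R. Beaton, *The critical surface fugacity of
self-avoiding walks on a rotated honeycomb lattice*, J. Phys. A 47 (2014) 075003 (arXiv:1210.0274), §2–§3 (the rotated
domain `D_{T,L}`: "height = length of the shortest walk from `a` to the top", the generating function `B_{T,L}` of walks
ending on the top boundary) and Appendix (PP-bridges); H. Duminil-Copin, S. Smirnov, Ann. of Math. 175 (2012), §3.

## What is proved (lane «pcv-sawmu», door D-ROT-2 «HEX-ROT-DICTIONARY» = face K95.6 `HexBW.RotDictionary` of a-idea-1's R95)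

Objects (token-identical to a-idea-1's `Sketch_G15_R95.lean`): the coordinate `HV.xX v = 3x₁ + b + 4` ALONG the start
column, the rotation `HV.rho` (`= rot3²`; `ξ ∘ ρ = −ht`: it carries the brick-wall height of the tree to Beaton's height),
**Beaton's rotated strip** `HV.rotStripV H W` (the vertices with `1 ≤ −ξ ≤ H`, `|X − 3| < 3W`, plus `a⁻ = wOut`, `a⁺ = O`),
the top exits `HV.IsRotTopDart H` and the partition function **`HV.rotStripBR H W = B^{⊥,→}_{H,W}(x_c)`** (right-started
mid-edge walks in `D(H,W) ∖ {a⁻}` ending through the top, weight `x_c^{#vertices}`).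

Printed status (lit-1 g10 cell, 2026-08-23): the mechanism is printed for Beaton's PP-bridges against the strip
function `B_T` (Appendix, proof of Corollary 15: "if a PP_T walk starts with a left turn, it is a ←B⁺_T walk with the first
step reflected; if it starts with a right turn, it is a →B⁺_T walk with an extra step attached to the start",
`PP_T = ←B⁺_T + x_c·→B⁺_T`, `2PP_T ≤ B_T ≤ (2/x_c)PP_T`); the version below (the tree's brick-wall span-`A` bridges into
the FINITE rotated domain `D(A, N)`, one-sided, constant `x_c⁻¹`) is a consolidation-grade dictionary step, first kernel text.

**`HexBW.rot_dictionary`** (= the face): for `A ≥ 1` and every `N`,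
`Σ_{m<N} #brSpan m A · μ_ℍ^{−m} ≤ x_c⁻¹ · rotStripBR A N`.  Proof: a brick-wall bridge of length `m` and span `A`
is (by `image_toBW_bridgeFin`) a list-model bridge `ω = [O, ω₁, …, ω_m]` with `0 < ht ωᵢ ≤ A = ht ω_m`; its image
`ρ ∘ ω` is a self-avoiding lattice path from `O` with Beaton heights `−ξ ∈ [1, A]` off `O`, ending at `−ξ = A`, and with
`|X − 4| ≤ 2m` (each edge moves `X` by `1` or `2`), so inside `D(A, N)` when `m < N`; prepending `a⁻ = wOut` and exiting
through the unique neighbour `xiDown` of the endpoint across the top (`ξ ↦ ξ − 1`) gives an element of the index set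
of `rotStripBR A N` with `m + 1` vertices, injectively (`rho_injective`); summing `x_c^{m+1}` over `m < N` (disjoint
images: different lengths) and using `μ_ℍ = x_c⁻¹` (`hexConnectiveConstant_eq_inv`) gives the claim.

## Contents (namespaces `…SAW.HV` and `…SAW.HexBW`, all PROVED)

`HV.xX`, `HV.rho` (+ `xi_rho`, `rho_adj`, `rho_injective`, `rho_hvOrigin`), `HV.xiDown` (+ `adj_xiDown`, `xi_xiDown`),
`HV.rotStripV`, `HV.mem_rotStripV_of`, `HV.IsRotTopDart`, `HV.rotStripBR`, `HV.rotStripBR_nonneg`, `HV.rotWalk` and its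
anatomy (`rotWalk_mem`, `mwLen_rotWalk`, `rotWalk_injOn`), `HexBW.card_brSpan_eq`, **`HexBW.rot_dictionary`**.
-/

noncomputable section

open Finset Literature.Probability.LatticeModels Literature.Probability.Percolation

namespace Literature.Probability.RandomPlanarGeometry.SAW

namespace HV

/-! ### Coordinates of the rotated frame -/

/-- `X = 3x₁ + b + 4`: the coordinate ALONG the line `ℓ` through the start edge (half-edge units; `a⁻ ↦ 2`,
`a⁺ ↦ 4`, `a ↦ 3`). [cite: Beaton2014RotatedHoneycomb, §2.2 (D_{T,L}, the start edge a⁻a⁺; arXiv v3 p. 5)] -/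
def xX (v : HV) : ℤ := 3 * v.2.1 + bit v + 4

/-- `a⁺ = hvOrigin ↦ X = 4`. [cite: Beaton2014RotatedHoneycomb, §2.2 (D_{T,L})] -/
theorem xX_hvOrigin : xX hvOrigin = 4 := by simp [xX, hvOrigin]

/-- Along an edge `X` moves by `1` or `2`. [cite: Beaton2014RotatedHoneycomb, §2.2 (D_{T,L}, the start edge a⁻a⁺; arXiv v3 p. 5)] -/
theorem abs_xX_sub_le_of_adj {u v : HV} (h : hvGraph.Adj u v) : |xX v - xX u| ≤ 2 := by
  obtain ⟨a, b, c⟩ := u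
  obtain ⟨a', b', c'⟩ := v
  rw [abs_le]
  cases c <;> cases c' <;> simp [hvGraph_adj, AdjRel, xX] at h ⊢ <;> omega

/-- The lattice rotation `ρ = rot3²` (order 3, fixes `hvOrigin`): `(a,b,false) ↦ (b,-a-b,false)`,
`(a,b,true) ↦ (b,-a-b-1,true)`; it carries the tree's brick-wall height `HV.ht v = x₀ - x₁` to Beaton's height:
`ξ (ρ v) = -ht v`. [cite: Beaton2014RotatedHoneycomb, §2 (Fig. 1)] -/
def rho (v : HV) : HV := (v.2.1, -v.1 - v.2.1 - bit v, v.2.2)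

/-- `ξ ∘ ρ = −ht`. [cite: Beaton2014RotatedHoneycomb, §2 (Fig. 1)] -/
theorem xi_rho (v : HV) : xi (rho v) = -ht v := by
  obtain ⟨a, b, c⟩ := v
  cases c <;> simp [xi, rho, ht, bit] <;> ring

/-- `ρ` fixes the origin. [cite: Beaton2014RotatedHoneycomb, §2 (Fig. 1)] -/
theorem rho_hvOrigin : rho hvOrigin = hvOrigin := by decide

/-- `ρ` preserves adjacency (it is the automorphism `rot3 ∘ rot3` of `ℍ`). [cite: Beaton2014RotatedHoneycomb, §2 (Fig. 1)] -/
theorem rho_adj {u v : HV} (h : hvGraph.Adj u v) : hvGraph.Adj (rho u) (rho v) := by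
  obtain ⟨a, b, c⟩ := u
  obtain ⟨a', b', c'⟩ := v
  cases c <;> cases c' <;> simp [hvGraph_adj, AdjRel, rho, bit] at h ⊢ <;> omega

/-- `ρ` is injective. [cite: Beaton2014RotatedHoneycomb, §2 (Fig. 1)] -/
theorem rho_injective : Function.Injective rho := by
  rintro ⟨a, b, c⟩ ⟨a', b', c'⟩ h
  cases c <;> cases c' <;> simp [rho, bit, Prod.ext_iff] at h ⊢ <;> omega

/-- The neighbour across which Beaton's height increases by one (`ξ ↦ ξ − 1`): `(a,b,true) ↦ (a,b,false)`,
`(a,b,false) ↦ (a-1,b,true)`. [cite: Beaton2014RotatedHoneycomb, §2.2 (the top boundary β^±)] -/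
def xiDown (v : HV) : HV := if v.2.2 then (v.1, v.2.1, false) else (v.1 - 1, v.2.1, true)

/-- `xiDown v` is a neighbour of `v`. [cite: Beaton2014RotatedHoneycomb, §2.2 (D_{T,L})] -/
theorem adj_xiDown (v : HV) : hvGraph.Adj v (xiDown v) := by
  obtain ⟨a, b, c⟩ := v
  cases c <;> simp [hvGraph_adj, AdjRel, xiDown]

/-- `ξ (xiDown v) = ξ v − 1`. [cite: Beaton2014RotatedHoneycomb, §2.2 (D_{T,L})] -/
theorem xi_xiDown (v : HV) : xi (xiDown v) = xi v - 1 := by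
  obtain ⟨a, b, c⟩ := v
  cases c
  · simp [xi, xiDown, bit]; ring
  · simp [xi, xiDown, bit]

/-! ### Beaton's rotated strip `D(H, W)` and its top partition function -/

/-- **Beaton's rotated strip domain** `D(H, W)` (`T = H + 1` in Beaton's normalisation "the height of the domain is
the length of the shortest walk starting at `a` and ending at the top boundary", §2.2): the vertices with `1 ≤ -ξ ≤ H`
and `|X - 3| < 3W`, together with `a⁻ = wOut` and `a⁺ = hvOrigin`; placed on the side `ξ ≤ -1` of `ℓ = {ξ = 0}`.
[cite: Beaton2014RotatedHoneycomb, §2.2 (the domain D_{T,L}; arXiv v3 p. 5)] -/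
def rotStripV (H Wd : ℕ) : Finset HV :=
  insert wOut (insert hvOrigin (
    ((Icc (-(H : ℤ) - 3 * Wd - 3) (3 * Wd + 3)) ×ˢ (Icc (-(3 : ℤ) * Wd - 3) (3 * Wd + 3)) ×ˢ
        (univ : Finset Bool)).filter
      (fun v => 1 ≤ -xi v ∧ -xi v ≤ H ∧ |xX v - 3| < 3 * Wd)))

/-- `a⁺ ∈ D(H, W)`. [cite: Beaton2014RotatedHoneycomb, §2.2 (D_{T,L})] -/
theorem hvOrigin_mem_rotStripV (H Wd : ℕ) : hvOrigin ∈ rotStripV H Wd :=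
  mem_insert_of_mem (mem_insert_self _ _)

/-- The box in `rotStripV` is large enough: membership is the three inequalities.
[cite: Beaton2014RotatedHoneycomb, §2.2 (D_{T,L})] -/
theorem mem_rotStripV_of {H Wd : ℕ} {v : HV} (h1 : 1 ≤ -xi v) (h2 : -xi v ≤ H) (h3 : |xX v - 3| < 3 * Wd) :
    v ∈ rotStripV H Wd := by
  obtain ⟨a, b, c⟩ := v
  simp only [rotStripV, mem_insert, mem_filter, mem_product, mem_Icc, mem_univ, and_true]
  refine Or.inr (Or.inr ⟨⟨⟨?_, ?_⟩, ?_, ?_⟩, h1, h2, h3⟩) <;>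
    cases c <;> simp [xi, xX, bit, abs_lt] at h1 h2 h3 ⊢ <;> omega

/-- A final half-edge through the TOP side of `D(H, W)`: from Beaton height `H` to `H + 1`.
[cite: Beaton2014RotatedHoneycomb, §2.2 (the top boundary β^±)] -/
def IsRotTopDart (H : ℕ) (d : HV × HV) : Prop := xi d.1 = -(H : ℤ) ∧ xi d.2 = -(H : ℤ) - 1

/-- Top exits are decidable. [cite: Beaton2014RotatedHoneycomb, §2.2 (the top boundary β^±)] -/
instance (H : ℕ) : DecidablePred (IsRotTopDart H) := fun d => by
  unfold IsRotTopDart; infer_instance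

/-- **`B^{⊥,→}_{H,W}(x_c)`**: the right-started walks (`a → a⁺ = hvOrigin → …`, i.e. the tree's mid-edge walks from the
dart `wOut → hvOrigin` inside `D(H,W) ∖ {a⁻}`) ending through the top side, weighted `x_c^{#vertices}`.  Beaton's
`B_{T,L}(x_c)` is `2 · rotStripBR (T-1) L` (reflection swapping `a∓`). [cite: Beaton2014RotatedHoneycomb, §2.2 (B_{T,L}(x) = Σ_{γ : a → β⁺ ∪ β⁻} x^{|γ|}; arXiv v3 p. 5)] -/
def rotStripBR (H Wd : ℕ) : ℝ :=
  ∑ P ∈ (midWalks ((rotStripV H Wd).erase wOut)).filter (fun P => IsRotTopDart H (finalDart P)),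
    hexCriticalFugacity ^ mwLen P

/-- `B^{⊥,→} ≥ 0`. [cite: Beaton2014RotatedHoneycomb, §2.2 (B_{T,L})] -/
theorem rotStripBR_nonneg (H Wd : ℕ) : 0 ≤ rotStripBR H Wd :=
  sum_nonneg fun _ _ => pow_nonneg hexCriticalFugacity_pos_lt_one.1.le _

/-! ### The dictionary: a bridge of span `A` gives a walk to the top of `D(A, N)` -/

/-- The image of a list-model bridge `ω = [O, ω₁, …, ω_m]` of the brick-wall frame: prepend `a⁻`, rotate by `ρ`, and exit
across the top through `xiDown` of the endpoint. [cite: Beaton2014RotatedHoneycomb, Appendix (PP-bridges)] -/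
def rotWalk (ω : List HV) : List HV :=
  wOut :: (ω.map rho ++ [xiDown (rho (ω.getLast?.getD hvOrigin))])

section Dictionary

variable {m A : ℕ} {ω : List HV}

/-- Unfolded membership in `bridgeFin`: chain from `O` of length `m + 1` without repetition, with the bridge heights.
[cite: MadrasSlade1993, Definition 1.2.4] -/
private theorem bridgeFin_anatomy (hω : ω ∈ bridgeFin m) :
    ω.IsChain hvGraph.Adj ∧ ω.head? = some hvOrigin ∧ ω.length = m + 1 ∧ ω.Nodup ∧ IsBridgeL m ω := by
  obtain ⟨hs, hb⟩ := mem_bridgeFin.1 hω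
  obtain ⟨hc, hh, hl, hn⟩ := mem_sawLists_iff.1 (mem_sawFin_iff.1 hs)
  exact ⟨hc, hh, hl, hn, hb⟩

/-- The first vertex of a list-model bridge is `O`. [cite: MadrasSlade1993, Definition 1.2.4] -/
private theorem getElem_zero_eq (hω : ω ∈ bridgeFin m) (h0 : 0 < ω.length) : ω[0] = hvOrigin := by
  obtain ⟨-, hh, -, -, -⟩ := bridgeFin_anatomy hω
  cases ω with
  | nil => simp at h0
  | cons a t => simpa using hh

/-- Heights along a list-model bridge of span `A`: the vertex `ωᵢ`, `i ≥ 1`, has `1 ≤ ht ωᵢ ≤ A`.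
[cite: MadrasSlade1993, Definition 1.2.4] -/
private theorem ht_getElem (hω : ω ∈ bridgeFin m) (hA : htAt ω m = A) {i : ℕ} (hi : i < ω.length) (hi1 : 1 ≤ i) :
    1 ≤ ht ω[i] ∧ ht ω[i] ≤ A := by
  obtain ⟨-, -, hl, -, hb⟩ := bridgeFin_anatomy hω
  have h := hb i hi1 (by omega)
  have e0 : htAt ω 0 = 0 := by
    rw [htAt, List.getD_eq_getElem _ _ (by omega : 0 < ω.length), getElem_zero_eq hω]; exact ht_hvOrigin
  have ei : htAt ω i = ht ω[i] := by rw [htAt, List.getD_eq_getElem _ _ hi]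
  rw [e0, ei, hA] at h
  exact ⟨by omega, h.2⟩

/-- The endpoint of a list-model bridge of span `A` has height `A`. [cite: MadrasSlade1993, Definition 1.2.4] -/
private theorem ht_getLast (hω : ω ∈ bridgeFin m) (hA : htAt ω m = A) (hne : ω ≠ []) : ht (ω.getLast hne) = A := by
  obtain ⟨-, -, hl, -, -⟩ := bridgeFin_anatomy hω
  rw [List.getLast_eq_getElem]
  have e : htAt ω m = ht ω[ω.length - 1] := by
    rw [htAt, List.getD_eq_getElem _ _ (by omega : m < ω.length)]
    congr 2
    omega
  rw [← e, hA]

/-- Along the rotated image the coordinate `X` stays within `2i` of `X(a⁺) = 4` after `i` steps.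
[cite: Beaton2014RotatedHoneycomb, §2.2 (D_{T,L})] -/
private theorem abs_xX_rho_getElem (hω : ω ∈ bridgeFin m) :
    ∀ {i : ℕ} (hi : i < ω.length), |xX (rho ω[i]) - 4| ≤ 2 * i := by
  obtain ⟨hc, -, -, -, -⟩ := bridgeFin_anatomy hω
  intro i
  induction i with
  | zero => intro hi; rw [getElem_zero_eq hω hi, rho_hvOrigin, xX_hvOrigin]; simp
  | succ i ih =>
    intro hi
    have h1 := ih (by omega)
    have hadj : hvGraph.Adj ω[i] ω[i + 1] := List.isChain_iff_getElem.1 hc i (by omega)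
    have h2 := abs_xX_sub_le_of_adj (rho_adj hadj)
    calc |xX (rho ω[i + 1]) - 4| = |(xX (rho ω[i + 1]) - xX (rho ω[i])) + (xX (rho ω[i]) - 4)| := by ring_nf
      _ ≤ |xX (rho ω[i + 1]) - xX (rho ω[i])| + |xX (rho ω[i]) - 4| := abs_add_le _ _
      _ ≤ 2 + 2 * i := add_le_add h2 h1
      _ = 2 * ((i + 1 : ℕ) : ℤ) := by push_cast; ring

/-- **The image walk is a top exit of `D(A, N)`** (`A ≥ 1`, `m < N`): `rotWalk ω` is a mid-edge walk in
`D(A, N) ∖ {a⁻}` whose final half-edge crosses the top. [cite: Beaton2014RotatedHoneycomb, §2.2 (D_{T,L}) and Appendix, proof of Corollary 15 (PP-bridges)] -/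
theorem rotWalk_mem {N : ℕ} (hA : 1 ≤ A) (hω : ω ∈ bridgeFin m) (hAm : htAt ω m = A) (hmN : m < N) :
    rotWalk ω ∈ (midWalks ((rotStripV A N).erase wOut)).filter (fun P => IsRotTopDart A (finalDart P)) := by
  obtain ⟨hc, hh, hl, hnd, -⟩ := bridgeFin_anatomy hω
  have hne : ω ≠ [] := by rintro rfl; simp at hl
  have hA' : (1 : ℤ) ≤ A := by exact_mod_cast hA
  set l : List HV := ω.map rho with hldef
  have hlne : l ≠ [] := by simpa [hldef] using hne
  have hlast : ω.getLast?.getD hvOrigin = ω.getLast hne := by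
    rw [List.getLast?_eq_some_getLast hne, Option.getD_some]
  have hllast : l.getLast hlne = rho (ω.getLast hne) := by
    simp only [hldef, List.getLast_map]
  set u : HV := xiDown (rho (ω.getLast hne)) with hudef
  have hP : rotWalk ω = wOut :: (l ++ [u]) := by
    rw [rotWalk, hlast]
  have hxu : xi u = -(A : ℤ) - 1 := by
    rw [hudef, xi_xiDown, xi_rho, ht_getLast hω hAm hne]
  -- heights of the vertices of `l`
  have hmem : ∀ x ∈ l, x = hvOrigin ∨ (1 ≤ -xi x ∧ -xi x ≤ A) := by
    intro x hx
    rw [hldef, List.mem_map] at hx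
    obtain ⟨y, hy, rfl⟩ := hx
    obtain ⟨i, hi, rfl⟩ := List.getElem_of_mem hy
    rcases Nat.eq_zero_or_pos i with rfl | hi0
    · left; rw [getElem_zero_eq hω hi, rho_hvOrigin]
    · right
      have := ht_getElem hω hAm hi hi0
      rw [xi_rho, neg_neg]
      exact this
  have hxi_ge : ∀ x ∈ wOut :: l, -(A : ℤ) ≤ xi x := by
    intro x hx
    rcases List.mem_cons.1 hx with rfl | hx
    · rw [xi_wOut]; omega
    · rcases hmem x hx with rfl | ⟨-, h2⟩
      · rw [xi_hvOrigin]; omega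
      · omega
  -- the coordinate `X` along `l`
  have hX : ∀ x ∈ l, |xX x - 3| < 3 * (N : ℤ) := by
    intro x hx
    rw [hldef, List.mem_map] at hx
    obtain ⟨y, hy, rfl⟩ := hx
    obtain ⟨i, hi, rfl⟩ := List.getElem_of_mem hy
    have h1 := abs_xX_rho_getElem hω hi
    have h2 : (i : ℤ) ≤ m := by exact_mod_cast (by omega : i ≤ m)
    have h3 : (m : ℤ) + 1 ≤ N := by exact_mod_cast hmN
    rw [abs_le] at h1
    rw [abs_lt]
    constructor <;> linarith [h1.1, h1.2]
  rw [mem_filter, mem_midWalks_iff, hP, finalDart_cons_append hlne]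
  refine ⟨(isMidWalk_cons_append_iff _ hlne _).2 ⟨?_, ?_, ?_, ?_, ?_, ?_⟩, ?_, hxu⟩
  · -- chain
    rw [hldef, List.isChain_map]
    exact List.IsChain.imp (fun a b h => rho_adj h) hc
  · -- starts at `O`
    rw [hldef, List.head?_map, hh, Option.map_some, rho_hvOrigin]
  · -- the exit half-edge
    rw [hllast]; exact adj_xiDown _
  · -- inside `D(A, N) ∖ {a⁻}`
    intro x hx
    rw [mem_erase]
    rcases hmem x hx with rfl | ⟨h1, h2⟩
    · exact ⟨by decide, hvOrigin_mem_rotStripV A N⟩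
    · refine ⟨fun h => ?_, mem_rotStripV_of h1 h2 (hX x hx)⟩
      rw [h, xi_wOut] at h1; omega
  · -- self-avoiding
    rw [hldef]; exact hnd.map rho_injective
  · -- the final half-edge is not retraced: `ξ` of the previous vertex is `≥ -A > ξ u`
    intro h
    have hp : prevOf l ∈ wOut :: l.dropLast := List.getLast_mem _
    have hp' : prevOf l ∈ wOut :: l := by
      rcases List.mem_cons.1 hp with e | e
      · exact List.mem_cons.2 (Or.inl e)
      · exact List.mem_cons_of_mem _ (List.dropLast_subset l e)
    have := hxi_ge _ hp'
    rw [← h, hxu] at this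
    omega
  · -- the start of the final dart is at height `A`
    rw [hllast, xi_rho, ht_getLast hω hAm hne]

/-- The image walk visits `m + 1` vertices. [cite: Beaton2014RotatedHoneycomb, §2.2 (D_{T,L})] -/
theorem mwLen_rotWalk (hω : ω ∈ bridgeFin m) : mwLen (rotWalk ω) = m + 1 := by
  obtain ⟨-, -, hl, -, -⟩ := bridgeFin_anatomy hω
  rw [rotWalk, mwLen_cons_append, List.length_map, hl]

/-- `rotWalk` is injective (on all lists). [cite: Beaton2014RotatedHoneycomb, Appendix (PP-bridges)] -/
theorem rotWalk_injective : Function.Injective rotWalk := by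
  intro ω ω' h
  have h1 := List.cons.inj h
  have h2 := congrArg List.dropLast h1.2
  rw [List.dropLast_concat, List.dropLast_concat] at h2
  exact (List.map_injective_iff.2 rho_injective) h2

end Dictionary

end HV

namespace HexBW

open HV

/-- The brick-wall bridges of span `A` counted in the list model: `#brSpan m A` is the number of list-model bridges
`ω ∈ bridgeFin m` with `ht ω_m = A` (transport `image_toBW_bridgeFin`, heights `toBW_apply_zero`).
[cite: MadrasSlade1993, Definition 1.2.4 and Definition 3.1.3] -/
theorem card_brSpan_eq (m : ℕ) (A : ℤ) :
    #(brSpan m A) = #((bridgeFin m).filter fun ω => htAt ω m = A) := by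
  classical
  have e : brSpan m A = ((bridgeFin m).filter fun ω => htAt ω m = A).image (toBW m) := by
    ext f
    simp only [brSpan, mem_filter, mem_image]
    rw [← image_toBW_bridgeFin, mem_image]
    constructor
    · rintro ⟨⟨ω, hω, rfl⟩, hf⟩
      exact ⟨ω, ⟨hω, by rwa [toBW_apply_zero ω le_rfl] at hf⟩, rfl⟩
    · rintro ⟨ω, ⟨hω, hA⟩, rfl⟩
      exact ⟨⟨ω, hω, rfl⟩, by rw [toBW_apply_zero ω le_rfl]; exact hA⟩
  rw [e, card_image_of_injOn]
  exact (toBW_injOn m).mono fun ω hω =>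
    Finset.mem_coe.2 (bridgeFin_subset m (Finset.mem_of_mem_filter ω (Finset.mem_coe.1 hω)))

/-- **The dictionary** (face K95.6 `HexBW.RotDictionary` of the lane's R95, token for token): for `A ≥ 1` and every
`N`, `Σ_{m<N} #brSpan m A · μ_ℍ^{−m} ≤ x_c⁻¹ · B^{⊥,→}_{A,N}(x_c)` — every brick-wall bridge of span `A` and length
`m < N` is carried by `rotWalk` (rotation `ρ`, prepend `a⁻`, exit across the top) to a distinct right-started walk to
the top of Beaton's domain `D(A, N)` with `m + 1` vertices, and `μ_ℍ = x_c⁻¹`.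
[cite: Beaton2014RotatedHoneycomb, Appendix, proof of Corollary 15 (PP_T = ←B⁺_T + x_c·→B⁺_T; 2PP_T ≤ B_T ≤ (2/x_c)PP_T; arXiv v3 p. 20); §2.2 (D_{T,L}, B_{T,L}; p. 5)]
[cite: DuminilCopinSmirnov2012, Thm 1] -/
theorem rot_dictionary (A N : ℕ) (hA : 1 ≤ A) :
    ∑ m ∈ range N, (#(brSpan m (A : ℤ)) : ℝ) / hexConnectiveConstant ^ m ≤
      hexCriticalFugacity⁻¹ * HV.rotStripBR A N := by
  classical
  set x := hexCriticalFugacity with hxdef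
  have hx0 : 0 < x := hexCriticalFugacity_pos_lt_one.1
  set S := (midWalks ((rotStripV A N).erase wOut)).filter (fun P => IsRotTopDart A (finalDart P)) with hSdef
  set BF : ℕ → Finset (List HV) := fun m => (bridgeFin m).filter fun ω => htAt ω m = (A : ℤ) with hBFdef
  set T : ℕ → Finset (List HV) := fun m => (BF m).image rotWalk with hTdef
  have hBF : ∀ m, ∀ ω ∈ BF m, ω ∈ bridgeFin m ∧ htAt ω m = (A : ℤ) := fun m ω hω => mem_filter.1 hω
  have hTS : ∀ m ∈ range N, T m ⊆ S := by
    intro m hm P hP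
    obtain ⟨ω, hω, rfl⟩ := mem_image.1 hP
    obtain ⟨h1, h2⟩ := hBF m ω hω
    exact rotWalk_mem hA h1 h2 (mem_range.1 hm)
  have hlen : ∀ m, ∀ P ∈ T m, mwLen P = m + 1 := by
    intro m P hP
    obtain ⟨ω, hω, rfl⟩ := mem_image.1 hP
    exact mwLen_rotWalk (hBF m ω hω).1
  have hcardT : ∀ m, #(T m) = #(BF m) := fun m =>
    card_image_of_injective _ rotWalk_injective
  have hdisj : ((range N : Finset ℕ) : Set ℕ).PairwiseDisjoint T := by
    intro m _ m' _ hmm'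
    rw [Function.onFun, Finset.disjoint_left]
    intro P hP hP'
    have := (hlen m P hP).symm.trans (hlen m' P hP')
    exact hmm' (by omega)
  -- rewrite the left side
  have hμ : hexConnectiveConstant = x⁻¹ := hexConnectiveConstant_eq_inv
  have hlhs : ∑ m ∈ range N, (#(brSpan m (A : ℤ)) : ℝ) / hexConnectiveConstant ^ m =
      x⁻¹ * ∑ m ∈ range N, ∑ P ∈ T m, x ^ mwLen P := by
    rw [mul_sum]
    refine sum_congr rfl fun m hm => ?_
    rw [sum_congr rfl fun P hP => by rw [hlen m P hP], sum_const, hcardT m, ← card_brSpan_eq, nsmul_eq_mul,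
      hμ, inv_pow, div_inv_eq_mul, pow_succ]
    field_simp
  rw [hlhs, ← sum_biUnion hdisj]
  refine mul_le_mul_of_nonneg_left ?_ (inv_nonneg.2 hx0.le)
  exact sum_le_sum_of_subset_of_nonneg (biUnion_subset.2 hTS) fun P _ _ => pow_nonneg hx0.le _

end HexBW

end Literature.Probability.RandomPlanarGeometry.SAW
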